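/-
Copyright (c) 2026 the pub-hodgecm-mathlib formalisation cell (harness21).  Prover seat hodgecm-mathlib-K2E3-p20 (g4), HCML Track B «K2-LIT» (build stream 29),
h413 = `stmt-HodgeConjecture-24833`, line `K2_E3_EllipticInputs`, unit U12 «Characters», socket #11 road (11-SC), letter (SC-an), END-GAME MAP v3, brick (M5a)+ —
the auxiliary-measure binders `hμQ` ∕ `hρ` of (M5a) ★ p856869 ∕ (M5b) ★ p856875 ∕ (M5e-1): EXISTENCE of a non-zero invariant Radon measure on `U(σ, Φ₃)(K) ⧸ T` (model and
place) and of the Haar measure of the diagonal torus `T`.  2026-09-04.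
-/
import Summits.HodgeConjecture.HodgeConjecture.Theorems.K2E3SplitTorusOrbitalBoundPlace   -- ★ p856925 (this seat): place frame; brings ★ p856869, ★ [M2a] `K2E3SupercuspModelFrameAtPlace`, ★ `ArchU21SplitIwasawa` ring-generic kit, ★ `isClosed_torusU_of_t1Space`
import Literature.MeasureTheory.Group.InvariantQuotientExistence                         -- ★ `exists_smulInvariantMeasure_integral_fiberIntegral_eq` (Deitmar–Echterhoff Thm 1.5.3, unimodular case)
import HarnessLib

/-!
# h413 ∕ Track B «K2-LIT», (SC-an) line, brick (M5a)+: THE AUXILIARY MEASURES OF THE SPLIT-TORUS BRICKS EXIST — a Haar measure on `T` and a NON-ZERO `U`-INVARIANT RADON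
# MEASURE ON `U(σ, Φ₃)(K) ⧸ T` (model, under unimodularity; at a non-split place `K = L_w`, unconditionally)
# (Deitmar–Echterhoff 2014, Thm 1.5.3; Folland 1995, Thm 2.49; Harish-Chandra 1970, Part VI §8 — `dx*` on `G∕A`)

Cell `pub/hodgecm-mathlib`, crux H413 = `stmt-HodgeConjecture-24833`, route of record `HCCMUnconditional`; chair K2-lead (g0), dealer K2E3-plan (g2), (SC-an) line lead
K2E3-p14 (g3).  THEOREMS ONLY (no `def`, no `instance`, no `notation`, no named-fact hypothesis, no `sorry`); lane `--supports stmt-HodgeConjecture-24833 --as helper`,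
count-neutral.  Default take announced `K2/STATUS.md` 2026-09-04T03:0xZ (the ε-road being fully staffed): the (M5e-1) assembly of the lead keeps `hμQ` (a `U`-invariant measure on
`U ⧸ T`, finite on compacta — and, for the unfolding constant of ★ (M5b) to be non-zero, `μQ ≠ 0`) and `hρ` (a left-invariant measure on `T`) as binders; this file DISCHARGES them.

THE MATHEMATICS.  Harish-Chandra's `∫_{G∕A} … dx*` [HarishChandra1970, Part VI §8 p. 60] is the (unique up to scalar) `G`-invariant Radon measure on `G ⧸ A`; it EXISTS iff
`Δ_G|_A = Δ_A` [DeitmarEchterhoff2014, Thm 1.5.3], in particular when `G` and `A` are unimodular — the tree's ★ `InvariantQuotientExistence.exists_smulInvariantMeasure_integral_fiberIntegral_eq`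
(hypotheses: a Haar measure on `G` that is right invariant, a Haar measure on the closed `A` that is inversion invariant).  For `U = U(σ, Φ₃)(K)` and `T` the diagonal torus:
`T` is closed (★ `isClosed_torusU_of_t1Space`) and ABELIAN, so its Haar measures are inversion invariant (★ `isInvInvariant_of_comm`); `U` is unimodular by the binder `hunimod`
of ★ p856869 (at `K = L_w`: ★ [M2a] `isMulRightInvariant_of_isHaarMeasure_of_eq_over`).  Regular ⇒ finite on compacta.

* §1 (model `U(σ, J)(R)` over a `T₁` topological ring, ANY `J`): `locallyCompactSpace_torusU`, `secondCountableTopology_torusU` (instances as theorems), `exists_isHaarMeasure_torusU`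
  (the `hρ` binder: `∃ ρ : Measure ↥T, ρ.IsHaarMeasure`).
* §2 (model, `hunimod`): **`exists_smulInvariantMeasure_quotient_torusU`** — `∃ μQ : Measure (↥U ⧸ torusU σ J), SMulInvariantMeasure ↥U _ μQ ∧ IsFiniteMeasureOnCompacts μQ ∧ μQ ≠ 0`
  for the consumer's Borel structure on the quotient (the `hμQ` binder; any `σ`, any `J`).
* §3 (place `K = L_w`, `σ = σ_w`, `J = Φ₃`): **`exists_smulInvariantMeasure_quotient_torusU_place`** — the same with `hunimod` and the countability ∕ local-compactness instances
  discharged (★ [M2a]).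

HONEST LABEL.  HC_CM is proved only modulo the 7 printed citations (2 remaining named inputs: hLiu418 = `stmt-HodgeConjecture-24832`, h413 = `stmt-HodgeConjecture-24833`)
until rung 0 closes; count-neutral helper (measure-theoretic plumbing for the (M5e)∕(M5h) assembly; nothing printed is asserted as a fact).

## References
* [DeitmarEchterhoff2014] A. Deitmar, S. Echterhoff, *Principles of Harmonic Analysis*, 2nd ed., Universitext (2014), Lemma 1.5.1, Thm. 1.5.3.
* [Folland1995] G. B. Folland, *A Course in Abstract Harmonic Analysis* (1995), §2.6 Thm. 2.49.
* [HarishChandra1970] Harish-Chandra (notes by G. van Dijk), *Harmonic Analysis on Reductive p-adic Groups*, LNM 162 (1970), Part VI §8 p. 60 (`dx*` on `G∕A`).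
* [Rogawski1990] J. D. Rogawski, *Automorphic Representations of Unitary Groups in Three Variables*, Ann. of Math. Stud. 123 (1990), §1.10 p. 9; §4.13 p. 70.
-/

set_option autoImplicit false
set_option linter.dupNamespace false  -- the mandated namespace repeats the single-problem summit's segment (`HodgeConjecture.HodgeConjecture`)

noncomputable section

open NumberField IsDedekindDomain MeasureTheory Measure Set
open scoped ENNReal NNReal Matrix MatrixGroups
open Literature.MeasureTheory.Group
open Literature.NumberTheory.Automorphic Literature.NumberTheory.Automorphic.UnitaryGroup Literature.NumberTheory.Rogawski1990
open Summit.HodgeConjecture.HodgeConjecture.Cruxes.H413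

namespace Summit.HodgeConjecture.HodgeConjecture.Cruxes.H413.K2E3SplitTorusQuotientMeasure

/-! ## §1 The diagonal torus: locally compact, second countable, has a Haar measure -/

section Torus

variable {R : Type*} [CommRing R] [TopologicalSpace R] [IsTopologicalRing R] [T1Space R] (σ : R →+* R) {N : ℕ} (J : Matrix (Fin N) (Fin N) R)

omit [IsTopologicalRing R] in
/-- `T` is locally compact (closed in the locally compact `U`, ★ `isClosed_torusU_of_t1Space`). [cite: Rogawski1990, §1.10 p. 9] -/
theorem locallyCompactSpace_torusU [LocallyCompactSpace ↥(unitaryGroupOfForm σ J)] : LocallyCompactSpace ↥(torusU σ J) :=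
  (isClosed_torusU_of_t1Space σ J).isClosedEmbedding_subtypeVal.locallyCompactSpace

omit [IsTopologicalRing R] [T1Space R] in
/-- `T` is second countable (a subspace of the second countable `U`). [cite: Rogawski1990, §1.10 p. 9] -/
theorem secondCountableTopology_torusU [SecondCountableTopology ↥(unitaryGroupOfForm σ J)] : SecondCountableTopology ↥(torusU σ J) :=
  TopologicalSpace.Subtype.secondCountableTopology _

/-- **THE `hρ` BINDER**: `T` carries a Haar measure (for the subtype Borel structure) — every such `ρ` is left invariant, σ-finite and finite on compacta, as ★ (M5b)
`lintegral_heightBall_conj_le` wants. [cite: Folland1995, §2.6] [cite: Rogawski1990, §1.10 p. 9] -/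
theorem exists_isHaarMeasure_torusU [LocallyCompactSpace ↥(unitaryGroupOfForm σ J)] [MeasurableSpace ↥(unitaryGroupOfForm σ J)] [BorelSpace ↥(unitaryGroupOfForm σ J)] :
    ∃ ρ : Measure ↥(torusU σ J), ρ.IsHaarMeasure := by
  haveI := locallyCompactSpace_torusU σ J
  exact ⟨Measure.haar, inferInstance⟩

end Torus

/-! ## §2 Model: a non-zero invariant Radon measure on `U(σ, J)(R) ⧸ T` under unimodularity -/

section Model

variable {R : Type*} [CommRing R] [TopologicalSpace R] [IsTopologicalRing R] [T1Space R] (σ : R →+* R) {N : ℕ} (J : Matrix (Fin N) (Fin N) R)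
  [MeasurableSpace ↥(unitaryGroupOfForm σ J)] [BorelSpace ↥(unitaryGroupOfForm σ J)]
  [T2Space ↥(unitaryGroupOfForm σ J)] [SecondCountableTopology ↥(unitaryGroupOfForm σ J)] [LocallyCompactSpace ↥(unitaryGroupOfForm σ J)]

/-- **THE `hμQ` BINDER — A NON-ZERO `U`-INVARIANT RADON MEASURE ON `U ⧸ T` EXISTS** (Harish-Chandra's `dx*` on `G ∕ A`): if every Haar measure of `U = U(σ, J)(R)` is right
invariant (`hunimod`; `U` second countable, locally compact, Hausdorff), then for the consumer's Borel structure on `↥U ⧸ torusU σ J` there is `μQ` with `SMulInvariantMeasure`,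
`IsFiniteMeasureOnCompacts` and `μQ ≠ 0` — ★ Deitmar–Echterhoff Thm 1.5.3 (unimodular case) with `T` closed abelian (its Haar measure inversion invariant, ★ `isInvInvariant_of_comm`).
[cite: DeitmarEchterhoff2014, Thm. 1.5.3] [cite: Folland1995, §2.6 Thm. 2.49] [cite: HarishChandra1970, Part VI §8 p. 60] -/
theorem exists_smulInvariantMeasure_quotient_torusU
    (hunimod : ∀ ν : Measure ↥(unitaryGroupOfForm σ J), ν.IsHaarMeasure → ν.IsMulRightInvariant)
    [MeasurableSpace (↥(unitaryGroupOfForm σ J) ⧸ torusU σ J)] [BorelSpace (↥(unitaryGroupOfForm σ J) ⧸ torusU σ J)] :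
    ∃ μQ : Measure (↥(unitaryGroupOfForm σ J) ⧸ torusU σ J),
      SMulInvariantMeasure ↥(unitaryGroupOfForm σ J) (↥(unitaryGroupOfForm σ J) ⧸ torusU σ J) μQ ∧ IsFiniteMeasureOnCompacts μQ ∧ μQ ≠ 0 := by
  have hT : IsClosed (torusU σ J : Set ↥(unitaryGroupOfForm σ J)) := isClosed_torusU_of_t1Space _ _
  haveI : LocallyCompactSpace ↥(torusU σ J) := hT.isClosedEmbedding_subtypeVal.locallyCompactSpace
  haveI : SecondCountableTopology ↥(torusU σ J) := TopologicalSpace.Subtype.secondCountableTopology _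
  set ρ : Measure ↥(torusU σ J) := Measure.haar with hρ
  haveI : ρ.IsInvInvariant :=
    Literature.MeasureTheory.Group.isInvInvariant_of_comm _ hT (fun x hx y hy => LineRing.forall_mem_torusU_comm σ J hy x hx) ρ
  set ν : Measure ↥(unitaryGroupOfForm σ J) := Measure.haar with hν
  haveI : ν.IsMulRightInvariant := hunimod ν inferInstance
  obtain ⟨μ, hinv, hreg, hne, -⟩ := exists_smulInvariantMeasure_integral_fiberIntegral_eq (torusU σ J) ρ hT ν
  haveI := hreg
  exact ⟨μ, hinv, inferInstance, hne⟩

end Model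

/-! ## §3 Place `K = L_w`: the invariant measure on `U(σ_w, Φ₃)(L_w) ⧸ T`, no structural hypothesis left -/

section Place

variable (L : Type) [Field L] [NumberField L] [IsCMField L] {v : HeightOneSpectrum (𝓞 ↥(maximalRealSubfield L))}
  (w : PlacesOver L v) (hw : IsCMField.complexConj L • w.1 = w.1)

/-- **A NON-ZERO INVARIANT RADON MEASURE ON `U(σ_w, Φ₃)(L_w) ⧸ T`** (the `hμQ` binder at the place): §2 with `hunimod` := ★ [M2a] `isMulRightInvariant_of_isHaarMeasure_of_eq_over` and
the instances ★ [M2a] §3.  Together with ★ p856925 (`hKB`) every structural binder of the split-torus bricks (M5a)(M5b) is now a theorem at the place.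
[cite: DeitmarEchterhoff2014, Thm. 1.5.3] [cite: HarishChandra1970, Part VI §8 p. 60] [cite: Rogawski1990, §4.13 p. 70] -/
theorem exists_smulInvariantMeasure_quotient_torusU_place {J : Matrix (Fin 3) (Fin 3) (w.1.adicCompletion L)}
    (hJ : J = (StdForm.antidiagonal 3).over (w.1.adicCompletion L))
    [MeasurableSpace ↥(unitaryGroupOfForm (galAdicCompletionMap (L := L) (IsCMField.complexConj L) hw) J)]
    [BorelSpace ↥(unitaryGroupOfForm (galAdicCompletionMap (L := L) (IsCMField.complexConj L) hw) J)]
    [MeasurableSpace (↥(unitaryGroupOfForm (galAdicCompletionMap (L := L) (IsCMField.complexConj L) hw) J) ⧸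
      torusU (galAdicCompletionMap (L := L) (IsCMField.complexConj L) hw) J)]
    [BorelSpace (↥(unitaryGroupOfForm (galAdicCompletionMap (L := L) (IsCMField.complexConj L) hw) J) ⧸
      torusU (galAdicCompletionMap (L := L) (IsCMField.complexConj L) hw) J)] :
    ∃ μQ : Measure (↥(unitaryGroupOfForm (galAdicCompletionMap (L := L) (IsCMField.complexConj L) hw) J) ⧸
        torusU (galAdicCompletionMap (L := L) (IsCMField.complexConj L) hw) J),
      SMulInvariantMeasure ↥(unitaryGroupOfForm (galAdicCompletionMap (L := L) (IsCMField.complexConj L) hw) J)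
          (↥(unitaryGroupOfForm (galAdicCompletionMap (L := L) (IsCMField.complexConj L) hw) J) ⧸
            torusU (galAdicCompletionMap (L := L) (IsCMField.complexConj L) hw) J) μQ ∧
        IsFiniteMeasureOnCompacts μQ ∧ μQ ≠ 0 := by
  haveI : SecondCountableTopology ↥(unitaryGroupOfForm (galAdicCompletionMap (L := L) (IsCMField.complexConj L) hw) J) :=
    K2E3SupercuspModelFrameAtPlace.secondCountableTopology_unitaryGroupOfForm_adicCompletion L w _ J
  haveI : LocallyCompactSpace ↥(unitaryGroupOfForm (galAdicCompletionMap (L := L) (IsCMField.complexConj L) hw) J) :=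
    K2E3SupercuspModelFrameAtPlace.locallyCompactSpace_unitaryGroupOfForm_adicCompletion L w hw J
  exact exists_smulInvariantMeasure_quotient_torusU (galAdicCompletionMap (L := L) (IsCMField.complexConj L) hw) J
    (fun ν _ => K2E3SupercuspModelFrameAtPlace.isMulRightInvariant_of_isHaarMeasure_of_eq_over L w hw hJ ν)

end Place

end Summit.HodgeConjecture.HodgeConjecture.Cruxes.H413.K2E3SplitTorusQuotientMeasure

end
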